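import Summits.QuantumFields.YangMills.Theorems.NotChatterjeeMassGapDictionary
import HarnessLib

/-!
# LINE L2 (ym-idea-4 g5) — the DICTIONARY, part 2: discharge of `hB` from Adhikari–Cao's Theorem 1.1
and the unconditional `correlationDecay → ¬ ChatterjeeMassGapProblem`

Everything here is fully proved; no new definitions, no new axioms.  The registered strong
hypothesis `ChatterjeeMassGapProblem` (a wave-0 transcription of Chatterjee's Problem 5.1 whose
`∀` ranges over all compact — hence all FINITE — non-abelian `G ⊂ U(N)`) is false as typed, given
the named fact `AdhikariCao2022.correlationDecay`.  Statement hygiene; nothing about `SU(N)`;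
no summit is proved.
-/

noncomputable section

open MeasureTheory ProbabilityTheory Filter Topology
open Literature.MathematicalPhysics.QuantumFieldTheory
open Literature.MathematicalPhysics.QuantumFieldTheory.AdhikariCao2022
open Literature.Probability.LatticeModels (box mem_box glueWith glueWith_apply_mem
  glueWith_apply_not_mem)

namespace Summit.QuantumFields.YangMills.Theorems.NotChatterjeeMassGap

/-! ### The class function `(1/N) Re χ_ρ` and the Gibbs sums -/

section ClassFunction

variable {G : Type*} [Group G] {N : ℕ} (ρ : G →* Matrix (Fin N) (Fin N) ℂ)

/-- `g ↦ (1/N) Re tr ρ(g)` is a class function (conjugacy invariant in its one slot).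
[cite: AdhikariCao2025, §1.2] -/
theorem isConjInvariant_traceObs :
    IsConjInvariant (fun g : Fin 1 → G => ((((N : ℝ)⁻¹ * (ρ (g 0)).trace.re : ℝ)) : ℂ)) := by
  intro g h
  have key : (ρ ((h 0)⁻¹ * g 0 * h 0)).trace = (ρ (g 0)).trace := by
    rw [map_mul, map_mul, Matrix.trace_mul_cycle, ← map_mul, mul_inv_cancel, map_one, one_mul]
  simp only [key]

/-- `‖(1/N) Re tr ρ‖_∞ ≤ 1` for unitary `ρ`. [cite: AdhikariCao2025, Thm. 1.1] -/
theorem supNorm_traceObs_le_one (hunit : ∀ g : G, ρ g ∈ Matrix.unitaryGroup (Fin N) ℂ) :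
    supNorm (fun g : Fin 1 → G => ((((N : ℝ)⁻¹ * (ρ (g 0)).trace.re : ℝ)) : ℂ)) ≤ 1 := by
  unfold supNorm
  refine ciSup_le fun g => ?_
  rw [Complex.norm_real, Real.norm_eq_abs]
  rcases Nat.eq_zero_or_pos N with hN | hN
  · subst hN; simp
  have h := abs_re_trace_le_of_mem_unitaryGroup (hunit (g 0))
  rw [abs_mul, abs_inv, Nat.abs_cast]
  calc (N : ℝ)⁻¹ * |(ρ (g 0)).trace.re| ≤ (N : ℝ)⁻¹ * N := by gcongr
    _ = 1 := inv_mul_cancel₀ (by exact_mod_cast hN.ne')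

omit [Group G] in
/-- `0 ≤ ‖f‖_∞`. [folklore] -/
theorem supNorm_nonneg {k : ℕ} (f : (Fin k → G) → ℂ) : 0 ≤ supNorm f :=
  Real.iSup_nonneg fun _ => norm_nonneg _

variable [Fintype G]

/-- Adhikari–Cao's (complex, bilinear) covariance of two real observables is the real covariance.
[cite: AdhikariCao2025, Thm. 1.1] -/
theorem cov_eq_ofReal {Λ : Cube} (β : ℝ) (F₁ F₂ : EdgeConfig Λ G → ℂ) (r₁ r₂ : EdgeConfig Λ G → ℝ)
    (h₁ : ∀ σ, F₁ σ = r₁ σ) (h₂ : ∀ σ, F₂ σ = r₂ σ) :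
    cov ρ β F₁ F₂ =
      (((∑ σ, gibbsProb ρ β σ * (r₁ σ * r₂ σ)) -
          (∑ σ, gibbsProb ρ β σ * r₁ σ) * ∑ σ, gibbsProb ρ β σ * r₂ σ : ℝ) : ℂ) := by
  have A : AdhikariCao2022.expect ρ β (fun σ => F₁ σ * F₂ σ) =
      ((∑ σ, gibbsProb ρ β σ * (r₁ σ * r₂ σ) : ℝ) : ℂ) := by
    unfold AdhikariCao2022.expect
    push_cast
    exact Finset.sum_congr rfl fun σ _ => by rw [h₁, h₂]
  have B : AdhikariCao2022.expect ρ β F₁ = ((∑ σ, gibbsProb ρ β σ * r₁ σ : ℝ) : ℂ) := by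
    unfold AdhikariCao2022.expect
    push_cast
    exact Finset.sum_congr rfl fun σ _ => by rw [h₁]
  have C : AdhikariCao2022.expect ρ β F₂ = ((∑ σ, gibbsProb ρ β σ * r₂ σ : ℝ) : ℂ) := by
    unfold AdhikariCao2022.expect
    push_cast
    exact Finset.sum_congr rfl fun σ _ => by rw [h₂]
  unfold cov
  rw [A, B, C]
  push_cast
  ring

end ClassFunction

/-! ### Gibbs sums of the cube are Sweep1's free-boundary expectations -/

section GibbsSums

variable {G : Type} [Group G] [Fintype G] [TopologicalSpace G] [DiscreteTopology G]
  [IsTopologicalGroup G] [MeasurableSpace G] [BorelSpace G] {N : ℕ}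
  (ρ : G →* Matrix (Fin N) (Fin N) ℂ)

/-- **Adhikari–Cao's Gibbs average on the cube is Sweep1's free-boundary expectation on
`box 4 L`** for continuous observables of the cube's links. [cite: AdhikariCao2025, §1.2 eq. (1.3)] -/
theorem sum_gibbsProb_mul_eq_zdExpect (β : ℝ) (L : ℕ) {F : ZdGaugeConfig 4 G → ℝ}
    (hFc : Continuous F)
    (hFdep : DependsOn F ((({ lower := fun _ => -(L : ℤ), side := 2 * L } : Cube).edges :
      Finset (ZdEdge 4)) : Set (ZdEdge 4))) :
    ∑ σ : EdgeConfig ({ lower := fun _ => -(L : ℤ), side := 2 * L } : Cube) G,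
        gibbsProb ρ β σ *
          F (glueWith ({ lower := fun _ => -(L : ℤ), side := 2 * L } : Cube).edges σ 1) =
      zdExpect ρ β (box 4 L) F := by
  classical
  rw [zdExpect_eq_sum_div_sum ρ β (box 4 L) _ (biUnion_bonds_subset_cube_edges L) hFc hFdep,
    Finset.sum_div]
  refine Finset.sum_congr rfl fun σ _ => ?_
  simp only [gibbsProb, weight, partitionFn, zdWilsonAction_glueWith_eq_action]
  ring

end GibbsSums

/-! ### Discharge of `hB` and the unconditional refutation -/

section Main

/-- **The dictionary hypothesis `hB` of `not_chatterjeeMassGapProblem_of_boxDecay`, PROVED from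
Adhikari–Cao's Theorem 1.1**: for a finite gauge group `G` with unitary `ρ`, at
`β ≥ (114 + 4 log|G|)/Δ_G`, the plaquette–plaquette covariance of Sweep1's free-boundary state on
`box 4 L` at axial separation `n ≥ 2` (`L ≥ n + 1`) is at most
`4 (4·10²⁴ |G|²)² e^{-(β/2) Δ_G (n-2)}` (unit squares: `|B₁| = |B₂| = 1`, `ℓ^∞`-distance `n - 1`,
class function `(1/N) Re χ_ρ` with `‖·‖_∞ ≤ 1`). [cite: AdhikariCao2025, Thm. 1.1] -/
theorem boxDecay_of_correlationDecay (hAC : correlationDecay) :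
    ∀ (G : Type) [Group G] [Fintype G] [TopologicalSpace G] [DiscreteTopology G]
      [IsTopologicalGroup G] [CompactSpace G] [MeasurableSpace G] [BorelSpace G] (N : ℕ)
      (ρ : G →* Matrix (Fin N) (Fin N) ℂ), (∀ g : G, ρ g ∈ Matrix.unitaryGroup (Fin N) ℂ) →
      ∀ β : ℝ, 114 + 4 * Real.log (Fintype.card G) ≤ deltaG ρ * β →
      ∀ n : ℕ, 2 ≤ n → ∀ L : ℕ, n + 1 ≤ L →
        |zdExpect ρ β (box 4 L) (fun U => zdPlaquetteObs ρ 0 0 1 U *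
              zdPlaquetteObs ρ (Pi.single (0 : Fin 4) (n : ℤ)) 0 1 U) -
            zdExpect ρ β (box 4 L) (zdPlaquetteObs ρ 0 0 1) *
              zdExpect ρ β (box 4 L) (zdPlaquetteObs ρ (Pi.single (0 : Fin 4) (n : ℤ)) 0 1)| ≤
          4 * (4 * 10 ^ 24 * (Fintype.card G : ℝ) ^ 2) ^ 2 *
            Real.exp (-(β / 2) * deltaG ρ * ((n : ℝ) - 2)) := by
  intro G _ _ _ _ _ _ _ _ N ρ hunit β hβ n hn L hL
  classical
  have hρc : Continuous ρ := continuous_of_discreteTopology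
  -- the two unit squares and their positions in the cube
  have ha₁ : ∀ k : Fin 4, -(L : ℤ) ≤ (0 : AdhikariCao2022.Site) k ∧ (0 : AdhikariCao2022.Site) k + 1 ≤ L := by
    intro k; simp; omega
  have ha₂ : ∀ k : Fin 4, -(L : ℤ) ≤ (Pi.single (0 : Fin 4) (n : ℤ) : AdhikariCao2022.Site) k ∧
      (Pi.single (0 : Fin 4) (n : ℤ) : AdhikariCao2022.Site) k + 1 ≤ L := by
    intro k; fin_cases k <;> simp <;> omega
  obtain ⟨γ₁, hγ₁, hhol₁⟩ := exists_plaquetteLoop (G := G)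
    ({ lower := fun _ => -(L : ℤ), side := 2 * L } : Cube) (0 : AdhikariCao2022.Site)
  obtain ⟨γ₂, hγ₂, hhol₂⟩ := exists_plaquetteLoop (G := G)
    ({ lower := fun _ => -(L : ℤ), side := 2 * L } : Cube)
    (Pi.single (0 : Fin 4) (n : ℤ) : AdhikariCao2022.Site)
  have hLr : (0 : ℝ) ≤ (n : ℝ) - 1 := by
    have : (2 : ℝ) ≤ n := by exact_mod_cast hn
    linarith
  -- Adhikari–Cao, Theorem 1.1
  have key := hAC G N ρ hunit ({ lower := fun _ => -(L : ℤ), side := 2 * L } : Cube) β hβ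
    ((n : ℝ) - 1) hLr
    { lo := (0 : AdhikariCao2022.Site), hi := 0 + Pi.single 0 1 + Pi.single 1 1 }
    { lo := (Pi.single (0 : Fin 4) (n : ℤ) : AdhikariCao2022.Site),
      hi := Pi.single (0 : Fin 4) (n : ℤ) + Pi.single 0 1 + Pi.single 1 1 }
    (unitSquare_lo_le_hi 0) (unitSquare_lo_le_hi _)
    (by rw [cube_vertices_eq_box]; exact unitSquare_vertices_subset_box ha₁)
    (by rw [cube_vertices_eq_box]; exact unitSquare_vertices_subset_box ha₂)
    (le_linfDist_unitSquares n) 1 1 le_rfl le_rfl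
    (fun g : Fin 1 → G => ((((N : ℝ)⁻¹ * (ρ (g 0)).trace.re : ℝ)) : ℂ))
    (fun g : Fin 1 → G => ((((N : ℝ)⁻¹ * (ρ (g 0)).trace.re : ℝ)) : ℂ))
    (isConjInvariant_traceObs ρ) (isConjInvariant_traceObs ρ)
    (fun _ => γ₁) (fun _ => γ₂) (fun _ => hγ₁) (fun _ => hγ₂)
  -- the two observables, read on the cube's link configurations
  have h₁ : ∀ σ : EdgeConfig ({ lower := fun _ => -(L : ℤ), side := 2 * L } : Cube) G,
      (fun g : Fin 1 → G => ((((N : ℝ)⁻¹ * (ρ (g 0)).trace.re : ℝ)) : ℂ))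
          (fun j : Fin 1 => holonomy σ ((fun _ : Fin 1 => γ₁) j)) =
        ((zdPlaquetteObs ρ 0 0 1
          (glueWith ({ lower := fun _ => -(L : ℤ), side := 2 * L } : Cube).edges σ 1) : ℝ) : ℂ) := by
    intro σ
    simp only [hhol₁ σ, zdPlaquetteObs_glueWith_edges_one]
  have h₂ : ∀ σ : EdgeConfig ({ lower := fun _ => -(L : ℤ), side := 2 * L } : Cube) G,
      (fun g : Fin 1 → G => ((((N : ℝ)⁻¹ * (ρ (g 0)).trace.re : ℝ)) : ℂ))
          (fun j : Fin 1 => holonomy σ ((fun _ : Fin 1 => γ₂) j)) =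
        ((zdPlaquetteObs ρ (Pi.single (0 : Fin 4) (n : ℤ)) 0 1
          (glueWith ({ lower := fun _ => -(L : ℤ), side := 2 * L } : Cube).edges σ 1) : ℝ) : ℂ) := by
    intro σ
    simp only [hhol₂ σ, zdPlaquetteObs_glueWith_edges_one]
  rw [cov_eq_ofReal ρ β _ _ _ _ h₁ h₂, Complex.norm_real, Real.norm_eq_abs,
    unitSquare_plaqCount, unitSquare_plaqCount] at key
  -- continuity and link-dependence of the plaquette observables
  have hc₁ : Continuous (zdPlaquetteObs (d := 4) ρ 0 0 1) := continuous_zdPlaquetteObs ρ hρc 0 0 1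
  have hc₂ : Continuous (zdPlaquetteObs (d := 4) ρ (Pi.single (0 : Fin 4) (n : ℤ)) 0 1) :=
    continuous_zdPlaquetteObs ρ hρc _ 0 1
  have hdep : ∀ {x : Literature.Probability.LatticeModels.Site 4},
      ((x, (0 : Fin 4), (1 : Fin 4)) : Plaq 4) ∈ plaquettesIn (box 4 L) →
      DependsOn (zdPlaquetteObs (d := 4) ρ x 0 1)
        ((({ lower := fun _ => -(L : ℤ), side := 2 * L } : Cube).edges : Finset (ZdEdge 4)) :
          Set (ZdEdge 4)) := by
    intro x hx U V h
    have hb := AreaLaw.dependsOn_plaquette_bonds (G := G) ((x, (0 : Fin 4), (1 : Fin 4)) : Plaq 4)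
      (x := U) (y := V) fun e he =>
        h e (Finset.mem_coe.2 (biUnion_bonds_subset_cube_edges L
          (Finset.mem_biUnion.2 ⟨_, hx, Finset.mem_coe.1 he⟩)))
    simp only at hb
    unfold zdPlaquetteObs
    rw [hb]
  have hd₁ := hdep (unitSquare_mem_plaquettesIn ha₁)
  have hd₂ := hdep (unitSquare_mem_plaquettesIn ha₂)
  have hd₁₂ : DependsOn (fun U : ZdGaugeConfig 4 G => zdPlaquetteObs ρ 0 0 1 U *
      zdPlaquetteObs ρ (Pi.single (0 : Fin 4) (n : ℤ)) 0 1 U)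
      ((({ lower := fun _ => -(L : ℤ), side := 2 * L } : Cube).edges : Finset (ZdEdge 4)) :
        Set (ZdEdge 4)) := by
    intro U V h
    simp only
    rw [hd₁ h, hd₂ h]
  -- the three Gibbs sums are the three free-boundary expectations
  have e₁₂ := sum_gibbsProb_mul_eq_zdExpect ρ β L
    (F := fun U : ZdGaugeConfig 4 G => zdPlaquetteObs ρ 0 0 1 U *
      zdPlaquetteObs ρ (Pi.single (0 : Fin 4) (n : ℤ)) 0 1 U) (hc₁.mul hc₂) hd₁₂
  have e₁ := sum_gibbsProb_mul_eq_zdExpect ρ β L hc₁ hd₁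
  have e₂ := sum_gibbsProb_mul_eq_zdExpect ρ β L hc₂ hd₂
  beta_reduce at e₁₂ key
  rw [e₁₂, e₁, e₂] at key
  refine key.trans ?_
  -- constants
  have hs1 := supNorm_traceObs_le_one ρ hunit
  have hs0 := supNorm_nonneg (fun g : Fin 1 → G => ((((N : ℝ)⁻¹ * (ρ (g 0)).trace.re : ℝ)) : ℂ))
  have hss : supNorm (fun g : Fin 1 → G => ((((N : ℝ)⁻¹ * (ρ (g 0)).trace.re : ℝ)) : ℂ)) *
      supNorm (fun g : Fin 1 → G => ((((N : ℝ)⁻¹ * (ρ (g 0)).trace.re : ℝ)) : ℂ)) ≤ 1 :=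
    mul_le_one₀ hs1 hs0 hs1
  have hK : (0 : ℝ) ≤ 4 * (4 * 10 ^ 24 * (Fintype.card G : ℝ) ^ 2) ^ (1 + 1) *
      Real.exp (-(β / 2) * deltaG ρ * ((n : ℝ) - 1 - 1)) := by positivity
  have hn2 : ((n : ℝ) - 1 - 1) = (n : ℝ) - 2 := by ring
  calc 4 * (4 * 10 ^ 24 * (Fintype.card G : ℝ) ^ 2) ^ (1 + 1) *
          supNorm (fun g : Fin 1 → G => ((((N : ℝ)⁻¹ * (ρ (g 0)).trace.re : ℝ)) : ℂ)) *
          supNorm (fun g : Fin 1 → G => ((((N : ℝ)⁻¹ * (ρ (g 0)).trace.re : ℝ)) : ℂ)) *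
          Real.exp (-(β / 2) * deltaG ρ * ((n : ℝ) - 1 - 1))
        = (4 * (4 * 10 ^ 24 * (Fintype.card G : ℝ) ^ 2) ^ (1 + 1) *
            Real.exp (-(β / 2) * deltaG ρ * ((n : ℝ) - 1 - 1))) *
          (supNorm (fun g : Fin 1 → G => ((((N : ℝ)⁻¹ * (ρ (g 0)).trace.re : ℝ)) : ℂ)) *
            supNorm (fun g : Fin 1 → G => ((((N : ℝ)⁻¹ * (ρ (g 0)).trace.re : ℝ)) : ℂ))) := by ring
    _ ≤ (4 * (4 * 10 ^ 24 * (Fintype.card G : ℝ) ^ 2) ^ (1 + 1) *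
            Real.exp (-(β / 2) * deltaG ρ * ((n : ℝ) - 1 - 1))) * 1 :=
        mul_le_mul_of_nonneg_left hss hK
    _ = 4 * (4 * 10 ^ 24 * (Fintype.card G : ℝ) ^ 2) ^ 2 *
          Real.exp (-(β / 2) * deltaG ρ * ((n : ℝ) - 2)) := by rw [mul_one, hn2]

/-- **LINE L2, UNCONDITIONAL IN THE DICTIONARY: the registered strong hypothesis
`ChatterjeeMassGapProblem` (cqft.S28 wave-0 transcription, `Literature/StrongHypotheses/QuantumFields`
row 6) is FALSE as typed, given the named fact `AdhikariCao2022.correlationDecay` (Adhikari–Cao,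
Thm 1.1).**  Finite non-abelian gauge groups (`S₃ ⊂ U(3)`) satisfy every hypothesis of its `∀` but
freeze at large `β` (`ξ ≤ 2/(β Δ_G)`).  Statement hygiene, not physics of `SU(N)`: no summit is
proved. [cite: AdhikariCao2025, Thm. 1.1] [cite: arXiv180301950, §5 Problem 5.1] -/
theorem not_chatterjeeMassGapProblem (hAC : correlationDecay) : ¬ ChatterjeeMassGapProblem :=
  not_chatterjeeMassGapProblem_of_boxDecay (fun h => boxDecay_of_correlationDecay h) hAC

end Main

end Summit.QuantumFields.YangMills.Theorems.NotChatterjeeMassGap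

end
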